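import Literature.NumberTheory.LFunctions.Zhang2022.EllRegimeK0Instances
import HarnessLib

/-!
# Zhang (2022), B-ell first-order reading: D-ELL-1-K0 v0.1 TABLE 1 in the kernel — test #1 on the three `K₀`
# vectors with the DERIVED coefficients, one-sided `λ`-box (cell `landau-siegel`, family B-ell; theorems only)

Topic `Literature/NumberTheory/LFunctions/Zhang2022` (Landau–Siegel audit tree; verdict-neutral).
Y. Zhang, arXiv:2211.02515v1 (2022) [Zhang2022LandauSiegel] is an unrefereed manuscript under
adjudication; NOTHING here asserts or denies its Theorems 1–2 and nothing here is a claim about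
Landau–Siegel zeros.  Theorems only (no `def`), over ls-Bell-typer-1's SET-form first-order vocabulary
(`EllRegime.firstOrderValue`, `ModelConsistentOn`, `ClosesFirstOrderOn`, `FirstOrderEmptyOn`; `EllRegimeStatements`
Part 6) and the parametric `K₀` rows of `EllRegimeK0Instances`.

SOURCE OF THE NUMBERS (derivation currency, NOT a kernel claim about Zhang's `Ξ_I`): ls-Bell-deriv-1 g0,
`B-ell/deriv-1/D-ELL-1-K0.md` v0.1 (sha16 `c639fc46be0504c8`, 2026-08-26T21:54Z; v0 `1b5c271132110f46` 21:31Z superseded: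
`t₀`-phase re-booked per residue, `Φ = (64,36,4) → (16,4,4)`; label «DERIVATION/HEUR until ls-theory reviews»), §3 Tables
A–C, §4 Table 1, §5 (5.1)–(5.2), §6, §9 D1.  Every row lemma below is PARAMETRIC in `(Φ, G, D)` (`modelConsistentOn_k0row`),
so a re-booking of a coefficient is a one-line re-instantiation.  In deriv-1's frame of record (ONE PIECE in
`L_M = log P` units, Zhang's shifts (2.13) verbatim) the coefficient of `1/A` in `Ξ_I(u,u)/(𝔞𝔓)` on a kernel vector
`u ∈ K₀` is the AFFINE functional
  `A·M(u; c′, τ₀, λ) = π²c′·D(u) − πτ₀·Φ(u) + λ·G₁(u)`                                             (5.1)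
with NO `ℓ`-gain term (`F_{b₀}(u) = 0`; §4 NOTE, D3), `D = (192, 176, 48)` (detuning, two-lineage certified:
K0FO-A kit j259598 / K0-ATOMS-A j259291 / lineage B), `Φ = (16, 4, 4)` (`t₀`-phase, Table B v0.1), `G₁ = −(128, 32, 32)·π`
(dipole, Table C; desk-twin floats hitting the displayed rationals to `1e−9`, two-lineage certification pending) on
`(k₁−k₃, k₁+k₂, k₂+k₃)`, and the model-admissible data set
  `𝓜 = {λ ∈ [−½ − o(1), λ_model]} × {c′ ≥ c′_det(τ₀) = (1+τ₀)/(2π)}`,  `λ_model ≤ −1.7171/log D < 0` (§6: the `λ`-box is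
ONE-SIDED), `τ₀ = 2 log t₀ / log D ≥ 0` fixed by the design.
In typer-1's vocabulary this is `firstOrderValue 0 (−πτ₀Φ(u)) (G₁(u)) (π²D(u)) (λ, c′)` (gain slot `0`), and we type:

* `modelConsistentOn_oneSided` / `firstOrderValue_oneSided_ge` — generic: gain `0`, `G₁ ≤ 0`, `G₂ ≥ 0` ⇒ on the box
  `[l₁, 0] × [c₁, ∞)` the value is bounded BELOW by its value `G₀ + c₁G₂` at the model corner `(0, c₁)` (deriv-1 (5.2):
  «inf over the data box = the model margin»); `modelConsistentOn_twoSided_of_abs` — the crude symmetric `λ`-box;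
  `k0row_margin` / `modelConsistentOn_k0row` / `modelConsistentOn_k0row_symm` — the PARAMETRIC `K₀` row
  `(0, −πτ₀Φ, −πG, π²D)`: margin `((1+τ₀)D/2 − τ₀Φ)π`, test #1 iff-free sufficient conditions;
* **TABLE 1 (v0.1)** `table1_margin_k13/k12/k23` — the model margins `(96 + 80τ₀)π`, `(88 + 84τ₀)π`, `(24 + 20τ₀)π`
  (exact identities), `modelConsistentOn_table1_k13/k12/k23` — **test #1 PASSES** on `[l₁, 0] × [c′_det(τ₀), ∞)` for
  every `τ₀ ≥ 0` and every `l₁` (deriv-1 §4/§5 verbatim), `…_symm` — also on the crude symmetric box `|λ| ≤ ½`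
  (margins `(32+80τ₀)π`, `(72+84τ₀)π`, `(8+20τ₀)π`), `…_noPhase` — the phase-free booking (a fortiori);
* `firstOrderEmptyOn_table1` — hence NO first-order robust closing on the three `K₀` vectors over any admissible box
  `M` that meets `𝓜` (KILL-draft §1 `K₀` clause, TIER 2 «DERIVED per D-ELL-1-K0» — to the extent v0.1 is reviewed);
* `d1Corner_k13/k12/k23` — deriv-1 §9 D1 (v0.1: RESOLVED): at the lattice-RE-CENTRED corner the detuning class reads
  `(1+τ₀)/2·(64, 16, 16)π` with the same phase coefficients, and the model value is `(32 + 16τ₀)π`, `(8 + 4τ₀)π`,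
  `(8 + 4τ₀)π ≥ 0` for every `τ₀ ≥ 0` (typed as exact identities; whether that corner is Lemma-2.3-admissible is
  theory's question (ii), not asserted here); `d1Probe_v0_k13_neg_iff` records v0's superseded booking (`Φ_old = 64`:
  negative iff `τ₀ > 1`) — the anomaly model positivity caught.

The PLANE form of the `K₀` test (REF-B2 21:18:07Z (r2), ls-Bell-plan 21:21:27Z: `2×2` Hermitian PSD on
`span_ℂ{k₁+k₂, k₂+k₃}`) is typed separately (`EllRegimeK0Plane`); this file is the three-vector table as printed in v0.

## References
* Y. Zhang, arXiv:2211.02515v1 (2022), §2 (2.13), Lemma 2.3 (2.15)–(2.16), (2.32)–(2.33); §7 (7.18)–(7.21);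
  §8 Lemmas 8.2–8.4. [Zhang2022LandauSiegel]

«The programme SEARCHES and TYPES; no claim about Landau–Siegel zeros, Theorems 1–2 of arXiv:2211.02515 or
a repaired Margin232 until a kernel theorem says so.»
-/

noncomputable section

open Real Set

namespace Literature.NumberTheory.LFunctions.Zhang2022.EllRegime

/-! ## Generic: gain `0`, one-sided `λ`-box, detuning half-line -/

/-- **inf over the one-sided box = the model corner value** (deriv-1 (5.2)): with gain `0`, `G₁ ≤ 0` and `G₂ ≥ 0`,
for every `(λ, c′) ∈ [l₁, 0] × [c₁, ∞)` the first-order value is `≥ G₀ + c₁·G₂`, its value at `(0, c₁)`.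
[cite: Zhang2022LandauSiegel, §2 Lemma 2.3, (2.13), (2.32)] -/
theorem firstOrderValue_oneSided_ge {G₀ G₁ G₂ l₁ c₁ : ℝ} (hG₁ : G₁ ≤ 0) (hG₂ : 0 ≤ G₂) :
    ∀ p ∈ Icc l₁ 0 ×ˢ Ici c₁, G₀ + c₁ * G₂ ≤ firstOrderValue 0 G₀ G₁ G₂ p := by
  rintro ⟨lam, c⟩ ⟨⟨_, hl⟩, hc⟩
  simp only [firstOrderValue, mem_Ici] at hc ⊢
  have h1 : 0 ≤ lam * G₁ := mul_nonneg_of_nonpos_of_nonpos hl hG₁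
  have h2 : c₁ * G₂ ≤ c * G₂ := mul_le_mul_of_nonneg_right hc hG₂
  linarith

/-- The model corner value is attained at `(0, c₁)`. [cite: Zhang2022LandauSiegel, §2 (2.13), (2.32)] -/
theorem firstOrderValue_modelCorner (G₀ G₁ G₂ c₁ : ℝ) :
    firstOrderValue 0 G₀ G₁ G₂ (0, c₁) = G₀ + c₁ * G₂ := by
  simp only [firstOrderValue]; ring

/-- **Test #1 on the one-sided box** from the sign structure: gain `0`, `G₁ ≤ 0`, `G₂ ≥ 0`, model corner value `≥ 0`.
[cite: Zhang2022LandauSiegel, §2 Lemma 2.3, (2.13), (2.32)] -/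
theorem modelConsistentOn_oneSided {G₀ G₁ G₂ l₁ c₁ : ℝ} (hG₁ : G₁ ≤ 0) (hG₂ : 0 ≤ G₂) (h : 0 ≤ G₀ + c₁ * G₂) :
    ModelConsistentOn (Icc l₁ 0 ×ˢ Ici c₁) 0 G₀ G₁ G₂ :=
  fun p hp => h.trans (firstOrderValue_oneSided_ge hG₁ hG₂ p hp)

/-- **Test #1 on the crude symmetric box** `[−Λ, Λ] × [c₁, ∞)` (deriv-1 §6: `Λ = ½` is the crude corollary): gain `0`,
`G₂ ≥ 0` and `Λ·|G₁| ≤ G₀ + c₁·G₂`. [cite: Zhang2022LandauSiegel, §2 Lemma 2.3, (2.13), (2.32)] -/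
theorem modelConsistentOn_twoSided_of_abs {G₀ G₁ G₂ Λ c₁ : ℝ} (hG₂ : 0 ≤ G₂)
    (h : Λ * |G₁| ≤ G₀ + c₁ * G₂) : ModelConsistentOn (Icc (-Λ) Λ ×ˢ Ici c₁) 0 G₀ G₁ G₂ := by
  rintro ⟨lam, c⟩ ⟨⟨hl₁, hl₂⟩, hc⟩
  simp only [firstOrderValue, mem_Ici] at hc ⊢
  have h2 : c₁ * G₂ ≤ c * G₂ := mul_le_mul_of_nonneg_right hc hG₂
  have h3 : -(Λ * |G₁|) ≤ lam * G₁ := by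
    have hlam : |lam| ≤ Λ := abs_le.mpr ⟨hl₁, hl₂⟩
    have := abs_mul lam G₁
    have h4 : |lam * G₁| ≤ Λ * |G₁| := by
      rw [this]; exact mul_le_mul_of_nonneg_right hlam (abs_nonneg _)
    have := neg_abs_le (lam * G₁)
    linarith
  linarith

/-! ## The parametric `K₀` row `(gain, G₀, G₁, G₂) = (0, −πτ₀Φ, −πG, π²D)` -/

/-- Margin of the parametric row at the model corner `(0, c′_det(τ₀))`: `−τ₀Φπ + (1+τ₀)/(2π)·Dπ² = ((1+τ₀)D/2 − τ₀Φ)·π`.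
[cite: Zhang2022LandauSiegel, §2 (2.13), (2.32)] -/
theorem k0row_margin (τ₀ Φ D : ℝ) :
    -(τ₀ * Φ * π) + (1 + τ₀) / (2 * π) * (D * π ^ 2) = ((1 + τ₀) * D / 2 - τ₀ * Φ) * π := by
  field_simp; ring

/-- **Test #1 for the parametric `K₀` row** on the one-sided box `[l₁, 0] × [c′_det(τ₀), ∞)`: sufficient that `G ≥ 0`,
`D ≥ 0` and `τ₀Φ ≤ (1+τ₀)D/2`. [cite: Zhang2022LandauSiegel, §2 Lemma 2.3, (2.13), (2.32)] -/
theorem modelConsistentOn_k0row {τ₀ Φ G D : ℝ} (l₁ : ℝ) (hG : 0 ≤ G) (hD : 0 ≤ D) (h : τ₀ * Φ ≤ (1 + τ₀) * D / 2) :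
    ModelConsistentOn (Icc l₁ 0 ×ˢ Ici ((1 + τ₀) / (2 * π))) 0 (-(τ₀ * Φ * π)) (-(G * π)) (D * π ^ 2) := by
  refine modelConsistentOn_oneSided (by nlinarith [pi_pos]) (by positivity) ?_
  rw [k0row_margin]
  have : 0 ≤ (1 + τ₀) * D / 2 - τ₀ * Φ := by linarith
  positivity

/-- **Lower bound for the parametric row**: every datum of the one-sided box has value `≥ ((1+τ₀)D/2 − τ₀Φ)π`
(`G, D ≥ 0`). [cite: Zhang2022LandauSiegel, §2 Lemma 2.3, (2.13), (2.32)] -/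
theorem k0row_inf {τ₀ Φ G D : ℝ} (l₁ : ℝ) (hG : 0 ≤ G) (hD : 0 ≤ D) :
    ∀ p ∈ Icc l₁ 0 ×ˢ Ici ((1 + τ₀) / (2 * π)),
      ((1 + τ₀) * D / 2 - τ₀ * Φ) * π ≤ firstOrderValue 0 (-(τ₀ * Φ * π)) (-(G * π)) (D * π ^ 2) p := by
  rw [← k0row_margin]
  exact firstOrderValue_oneSided_ge (by nlinarith [pi_pos]) (by positivity)

/-- **Test #1 for the parametric row on the crude symmetric box** `|λ| ≤ Λ`: sufficient that `G, D ≥ 0`, `Λ ≥ 0` and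
`Λ·G ≤ (1+τ₀)D/2 − τ₀Φ`. [cite: Zhang2022LandauSiegel, §2 Lemma 2.3, (2.13), (2.32)] -/
theorem modelConsistentOn_k0row_symm {τ₀ Φ G D Λ : ℝ} (hG : 0 ≤ G) (hD : 0 ≤ D)
    (h : Λ * G ≤ (1 + τ₀) * D / 2 - τ₀ * Φ) :
    ModelConsistentOn (Icc (-Λ) Λ ×ˢ Ici ((1 + τ₀) / (2 * π))) 0 (-(τ₀ * Φ * π)) (-(G * π)) (D * π ^ 2) := by
  refine modelConsistentOn_twoSided_of_abs (by positivity) ?_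
  rw [k0row_margin, abs_neg, abs_of_nonneg (by positivity)]
  nlinarith [pi_pos]

/-! ## TABLE 1 (D-ELL-1-K0 v0.1 §4): the model margins, exact -/

/-- `k₁−k₃`: `−16τ₀·π + c′_det(τ₀)·192π² = (96 + 80τ₀)·π`. [cite: Zhang2022LandauSiegel, §2 (2.13), (2.32)] -/
theorem table1_margin_k13 (τ₀ : ℝ) : -(τ₀ * 16 * π) + (1 + τ₀) / (2 * π) * (192 * π ^ 2) = (96 + 80 * τ₀) * π := by
  field_simp; ring

/-- `k₁+k₂`: `−4τ₀·π + c′_det(τ₀)·176π² = (88 + 84τ₀)·π`. [cite: Zhang2022LandauSiegel, §2 (2.13), (2.32)] -/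
theorem table1_margin_k12 (τ₀ : ℝ) : -(τ₀ * 4 * π) + (1 + τ₀) / (2 * π) * (176 * π ^ 2) = (88 + 84 * τ₀) * π := by
  field_simp; ring

/-- `k₂+k₃`: `−4τ₀·π + c′_det(τ₀)·48π² = (24 + 20τ₀)·π`. [cite: Zhang2022LandauSiegel, §2 (2.13), (2.32)] -/
theorem table1_margin_k23 (τ₀ : ℝ) : -(τ₀ * 4 * π) + (1 + τ₀) / (2 * π) * (48 * π ^ 2) = (24 + 20 * τ₀) * π := by
  field_simp; ring

/-- **inf over `𝓜` = the Table-1 margin, `k₁−k₃`**: every `(λ, c′) ∈ [l₁, 0] × [c′_det(τ₀), ∞)` has value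
`≥ (96 + 80τ₀)π`. [cite: Zhang2022LandauSiegel, §2 Lemma 2.3, (2.13), (2.32)] -/
theorem table1_inf_k13 (τ₀ l₁ : ℝ) : ∀ p ∈ Icc l₁ 0 ×ˢ Ici ((1 + τ₀) / (2 * π)),
    (96 + 80 * τ₀) * π ≤ firstOrderValue 0 (-(τ₀ * 16 * π)) (-(128 * π)) (192 * π ^ 2) p := by
  rw [← table1_margin_k13]
  exact firstOrderValue_oneSided_ge (by nlinarith [pi_pos]) (by positivity)

/-- Same, `k₁+k₂`: value `≥ (88 + 84τ₀)π`. [cite: Zhang2022LandauSiegel, §2 Lemma 2.3, (2.13), (2.32)] -/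
theorem table1_inf_k12 (τ₀ l₁ : ℝ) : ∀ p ∈ Icc l₁ 0 ×ˢ Ici ((1 + τ₀) / (2 * π)),
    (88 + 84 * τ₀) * π ≤ firstOrderValue 0 (-(τ₀ * 4 * π)) (-(32 * π)) (176 * π ^ 2) p := by
  rw [← table1_margin_k12]
  exact firstOrderValue_oneSided_ge (by nlinarith [pi_pos]) (by positivity)

/-- Same, `k₂+k₃`: value `≥ (24 + 20τ₀)π`. [cite: Zhang2022LandauSiegel, §2 Lemma 2.3, (2.13), (2.32)] -/
theorem table1_inf_k23 (τ₀ l₁ : ℝ) : ∀ p ∈ Icc l₁ 0 ×ˢ Ici ((1 + τ₀) / (2 * π)),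
    (24 + 20 * τ₀) * π ≤ firstOrderValue 0 (-(τ₀ * 4 * π)) (-(32 * π)) (48 * π ^ 2) p := by
  rw [← table1_margin_k23]
  exact firstOrderValue_oneSided_ge (by nlinarith [pi_pos]) (by positivity)

/-! ## TABLE 1: test #1 PASSES on the three `K₀` vectors (every `τ₀ ≥ 0`, one-sided `λ`-box) -/

/-- **Test #1, `k₁−k₃`** (D-ELL-1-K0 v0.1 Table 1 row 1): on `𝓜 = [l₁, 0] × [c′_det(τ₀), ∞)`, `τ₀ ≥ 0`.
[cite: Zhang2022LandauSiegel, §2 Lemma 2.3, (2.13), (2.32)] -/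
theorem modelConsistentOn_table1_k13 {τ₀ : ℝ} (l₁ : ℝ) (hτ : 0 ≤ τ₀) :
    ModelConsistentOn (Icc l₁ 0 ×ˢ Ici ((1 + τ₀) / (2 * π))) 0 (-(τ₀ * 16 * π)) (-(128 * π)) (192 * π ^ 2) :=
  fun p hp => le_trans (by positivity) (table1_inf_k13 τ₀ l₁ p hp)

/-- **Test #1, `k₁+k₂`** (Table 1 row 2). [cite: Zhang2022LandauSiegel, §2 Lemma 2.3, (2.13), (2.32)] -/
theorem modelConsistentOn_table1_k12 {τ₀ : ℝ} (l₁ : ℝ) (hτ : 0 ≤ τ₀) :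
    ModelConsistentOn (Icc l₁ 0 ×ˢ Ici ((1 + τ₀) / (2 * π))) 0 (-(τ₀ * 4 * π)) (-(32 * π)) (176 * π ^ 2) :=
  fun p hp => le_trans (by positivity) (table1_inf_k12 τ₀ l₁ p hp)

/-- **Test #1, `k₂+k₃`** (Table 1 row 3). [cite: Zhang2022LandauSiegel, §2 Lemma 2.3, (2.13), (2.32)] -/
theorem modelConsistentOn_table1_k23 {τ₀ : ℝ} (l₁ : ℝ) (hτ : 0 ≤ τ₀) :
    ModelConsistentOn (Icc l₁ 0 ×ˢ Ici ((1 + τ₀) / (2 * π))) 0 (-(τ₀ * 4 * π)) (-(32 * π)) (48 * π ^ 2) :=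
  fun p hp => le_trans (by positivity) (table1_inf_k23 τ₀ l₁ p hp)

/-- **Crude symmetric `λ`-box `|λ| ≤ ½`** (deriv-1 §6 corollary), `k₁−k₃`: margin `(96+80τ₀)π − 64π = (32+80τ₀)π ≥ 0`.
[cite: Zhang2022LandauSiegel, §2 Lemma 2.3, (2.13), (2.32)] -/
theorem modelConsistentOn_table1_k13_symm {τ₀ : ℝ} (hτ : 0 ≤ τ₀) :
    ModelConsistentOn (Icc (-(1 / 2)) (1 / 2) ×ˢ Ici ((1 + τ₀) / (2 * π))) 0 (-(τ₀ * 16 * π)) (-(128 * π))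
      (192 * π ^ 2) :=
  modelConsistentOn_k0row_symm (by norm_num) (by norm_num) (by nlinarith)

/-- Same, `k₁+k₂`: margin `(88+84τ₀)π − 16π ≥ 0`. [cite: Zhang2022LandauSiegel, §2 Lemma 2.3, (2.13), (2.32)] -/
theorem modelConsistentOn_table1_k12_symm {τ₀ : ℝ} (hτ : 0 ≤ τ₀) :
    ModelConsistentOn (Icc (-(1 / 2)) (1 / 2) ×ˢ Ici ((1 + τ₀) / (2 * π))) 0 (-(τ₀ * 4 * π)) (-(32 * π))
      (176 * π ^ 2) :=
  modelConsistentOn_k0row_symm (by norm_num) (by norm_num) (by nlinarith)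

/-- Same, `k₂+k₃`: margin `(24+20τ₀)π − 16π = (8+20τ₀)π ≥ 0`. [cite: Zhang2022LandauSiegel, §2 Lemma 2.3, (2.13), (2.32)] -/
theorem modelConsistentOn_table1_k23_symm {τ₀ : ℝ} (hτ : 0 ≤ τ₀) :
    ModelConsistentOn (Icc (-(1 / 2)) (1 / 2) ×ˢ Ici ((1 + τ₀) / (2 * π))) 0 (-(τ₀ * 4 * π)) (-(32 * π))
      (48 * π ^ 2) :=
  modelConsistentOn_k0row_symm (by norm_num) (by norm_num) (by nlinarith)

/-- **The phase-free booking** (`G₀ = 0`; Table 1 then reads `(96, 88, 24)(1+τ₀)π`): test #1 passes a fortiori, all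
three rows, one-sided box, `τ₀ ≥ −1`. [cite: Zhang2022LandauSiegel, §2 Lemma 2.3, (2.13), (2.32)] -/
theorem modelConsistentOn_table1_noPhase {τ₀ D G : ℝ} (l₁ : ℝ) (hτ : -1 ≤ τ₀) (hD : 0 ≤ D) (hG : 0 ≤ G) :
    ModelConsistentOn (Icc l₁ 0 ×ˢ Ici ((1 + τ₀) / (2 * π))) 0 0 (-(G * π)) (D * π ^ 2) := by
  refine modelConsistentOn_oneSided (by nlinarith [pi_pos]) (by positivity) ?_
  have : (0 : ℝ) + (1 + τ₀) / (2 * π) * (D * π ^ 2) = (1 + τ₀) * D * π / 2 := by field_simp; ring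
  rw [this]
  have : 0 ≤ (1 + τ₀) * D := mul_nonneg (by linarith) hD
  positivity

/-! ## The `K₀` word at first order, three-vector form: no robust closing over any box meeting `𝓜` -/

/-- **D-ELL-1-K0 v0.1 §5 «K₀ WORD (first order): no»** in the kernel: with deriv-1's coefficients (gain `0`,
`G₀ = −πτ₀Φ(u)`, `G₁(u)`, `G₂ = π²D(u)`) on the rows `(k₁−k₃, k₁+k₂, k₂+k₃)`, NO row closes robustly over an
admissible box `M` containing a model datum `(λ₀, c₀)` with `l₁ ≤ λ₀ ≤ 0`, `c₀ ≥ c′_det(τ₀)`, for any `τ₀ ≥ 0`.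
[cite: Zhang2022LandauSiegel, §2 Lemma 2.3, (2.13), (2.32)] -/
theorem firstOrderEmptyOn_table1 {τ₀ l₁ lam₀ c₀ : ℝ} {M : Set (ℝ × ℝ)} (hτ : 0 ≤ τ₀)
    (hl : l₁ ≤ lam₀) (hl' : lam₀ ≤ 0) (hc₀ : (1 + τ₀) / (2 * π) ≤ c₀) (hM : (lam₀, c₀) ∈ M) :
    FirstOrderEmptyOn (Set.univ : Set (Fin 3))
      ![((0 : ℝ), -(τ₀ * 16 * π), -(128 * π), 192 * π ^ 2),
        ((0 : ℝ), -(τ₀ * 4 * π), -(32 * π), 176 * π ^ 2),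
        ((0 : ℝ), -(τ₀ * 4 * π), -(32 * π), 48 * π ^ 2)] M := by
  have hmem : (lam₀, c₀) ∈ Icc l₁ 0 ×ˢ Ici ((1 + τ₀) / (2 * π)) := ⟨⟨hl, hl'⟩, hc₀⟩
  intro i _
  fin_cases i
  · exact not_closesFirstOrderOn_of_mem (modelConsistentOn_table1_k13 l₁ hτ) hmem hM
  · exact not_closesFirstOrderOn_of_mem (modelConsistentOn_table1_k12 l₁ hτ) hmem hM
  · exact not_closesFirstOrderOn_of_mem (modelConsistentOn_table1_k23 l₁ hτ) hmem hM

/-- The same over the crude symmetric box: any `M ∋ (λ₀, c₀)` with `|λ₀| ≤ ½`, `c₀ ≥ c′_det(τ₀)`.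
[cite: Zhang2022LandauSiegel, §2 Lemma 2.3, (2.13), (2.32)] -/
theorem firstOrderEmptyOn_table1_symm {τ₀ lam₀ c₀ : ℝ} {M : Set (ℝ × ℝ)} (hτ : 0 ≤ τ₀)
    (hl : |lam₀| ≤ 1 / 2) (hc₀ : (1 + τ₀) / (2 * π) ≤ c₀) (hM : (lam₀, c₀) ∈ M) :
    FirstOrderEmptyOn (Set.univ : Set (Fin 3))
      ![((0 : ℝ), -(τ₀ * 16 * π), -(128 * π), 192 * π ^ 2),
        ((0 : ℝ), -(τ₀ * 4 * π), -(32 * π), 176 * π ^ 2),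
        ((0 : ℝ), -(τ₀ * 4 * π), -(32 * π), 48 * π ^ 2)] M := by
  have hmem : (lam₀, c₀) ∈ Icc (-(1 / 2 : ℝ)) (1 / 2) ×ˢ Ici ((1 + τ₀) / (2 * π)) :=
    ⟨⟨(abs_le.mp hl).1, (abs_le.mp hl).2⟩, hc₀⟩
  intro i _
  fin_cases i
  · exact not_closesFirstOrderOn_of_mem (modelConsistentOn_table1_k13_symm hτ) hmem hM
  · exact not_closesFirstOrderOn_of_mem (modelConsistentOn_table1_k12_symm hτ) hmem hM
  · exact not_closesFirstOrderOn_of_mem (modelConsistentOn_table1_k23_symm hτ) hmem hM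

/-! ## D1 (D-ELL-1-K0 v0.1 §9, RESOLVED): the lattice-re-centred corner — exact values -/

/-- **D1 corner, `k₁−k₃`** (v0.1): re-centred detuning class `64π²` in place of `192π²`, same phase coefficient `16`:
the model value at `(0, c′_det(τ₀))` is `(32 + 16τ₀)π`. [cite: Zhang2022LandauSiegel, §2 Lemma 2.3 (2.15)–(2.16), (2.32)] -/
theorem d1Corner_k13_eq (τ₀ G₁ : ℝ) :
    firstOrderValue 0 (-(τ₀ * 16 * π)) G₁ (64 * π ^ 2) (0, (1 + τ₀) / (2 * π)) = (32 + 16 * τ₀) * π := by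
  simp only [firstOrderValue]; field_simp; ring

/-- **D1 corner, `k₁+k₂`** and **`k₂+k₃`** (v0.1): detuning class `16π²`, phase coefficient `4`: model value `(8 + 4τ₀)π`.
[cite: Zhang2022LandauSiegel, §2 Lemma 2.3 (2.15)–(2.16), (2.32)] -/
theorem d1Corner_k12_k23_eq (τ₀ G₁ : ℝ) :
    firstOrderValue 0 (-(τ₀ * 4 * π)) G₁ (16 * π ^ 2) (0, (1 + τ₀) / (2 * π)) = (8 + 4 * τ₀) * π := by
  simp only [firstOrderValue]; field_simp; ring

/-- **D1 corner passes test #1 too** (v0.1 §4 «Also PASS at the lattice-re-centred corner»): all three corner rows are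
model-consistent on the one-sided box for every `τ₀ ≥ 0` (indeed the parametric criterion `τ₀Φ ≤ (1+τ₀)D/2` holds with
room). [cite: Zhang2022LandauSiegel, §2 Lemma 2.3 (2.15)–(2.16), (2.32)] -/
theorem modelConsistentOn_d1Corner {τ₀ : ℝ} (l₁ : ℝ) (hτ : 0 ≤ τ₀) :
    ModelConsistentOn (Icc l₁ 0 ×ˢ Ici ((1 + τ₀) / (2 * π))) 0 (-(τ₀ * 16 * π)) (-(128 * π)) (64 * π ^ 2) ∧
    ModelConsistentOn (Icc l₁ 0 ×ˢ Ici ((1 + τ₀) / (2 * π))) 0 (-(τ₀ * 4 * π)) (-(32 * π)) (16 * π ^ 2) :=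
  ⟨modelConsistentOn_k0row l₁ (by norm_num) (by norm_num) (by nlinarith),
   modelConsistentOn_k0row l₁ (by norm_num) (by norm_num) (by nlinarith)⟩

/-- **v0's superseded booking, for the record** (`Φ_old(k₁−k₃) = 64`, global phase): the re-centred corner value
`(32 − 32τ₀)π` is negative iff `τ₀ > 1` — the anomaly that model positivity caught (v0.1 §0.3, §9 D1).
[cite: Zhang2022LandauSiegel, §2 Lemma 2.3 (2.15)–(2.16), (2.32)] -/
theorem d1Probe_v0_k13_neg_iff (τ₀ G₁ : ℝ) :
    firstOrderValue 0 (-(τ₀ * 64 * π)) G₁ (64 * π ^ 2) (0, (1 + τ₀) / (2 * π)) < 0 ↔ 1 < τ₀ := by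
  have e : firstOrderValue 0 (-(τ₀ * 64 * π)) G₁ (64 * π ^ 2) (0, (1 + τ₀) / (2 * π)) = (32 - 32 * τ₀) * π := by
    simp only [firstOrderValue]; field_simp; ring
  rw [e]
  constructor
  · intro h; nlinarith [pi_pos]
  · intro h; nlinarith [pi_pos]

end Literature.NumberTheory.LFunctions.Zhang2022.EllRegime

end
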